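import Literature.AlgebraicGeometry.Motives.LocalSystems
import HarnessLib

/-!
# Local systems on a simply connected base are trivial (proofs)

This file discharges the named fact
`Literature.AlgebraicGeometry.Motives.LocalSystem.isTrivial_of_simplyConnectedSpace` of
`Literature.AlgebraicGeometry.Motives.LocalSystems`: on a simply connected space `S`, every
local system `V : Π₁(S) ⥤ ModuleCat R` is isomorphic to a constant one.

Source: P. Deligne, *Équations différentielles à points singuliers réguliers*, LNM 163 (1970),
I.1 "Systèmes locaux et groupe fondamental": for `X` connected, locally path connected and
locally simply connected with base point `x₀` (hypotheses 1.2), the fibre functor `F ↦ F_{x₀}` is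
an equivalence between locally constant sheaves on `X` and `π₁(X, x₀)`-sets (Prop. 1.3), resp.
between complex local systems and finite-dimensional representations of `π₁(X, x₀)` (Cor. 1.4),
the transport `a(F) : F_{a(0)} ≅ F_{a(1)}` along a path `a` depending only on its homotopy class
(1.2). When `π₁(X, x₀) = 1` the constant sheaf with fibre `F_{x₀}` and `F` have the same image,
so `F` is constant. (Also Voisin, *Hodge Theory and Complex Algebraic Geometry I*, §9.2.)

In the `Π₁(S) ⥤ ModuleCat R` incarnation used by `LocalSystems` the argument is direct: a simply
connected space is nonempty and has exactly one homotopy class of paths `γ_s : s ⤳ s₀` for each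
`s`; the transports `V(γ_s) : V_s ≅ V_{s₀}` form a natural isomorphism `V ≅ const (V_{s₀})`
because `f ≫ γ_t = γ_s` for every `f : s ⤳ t`.

## Main results

* `LocalSystem.hom_ext_of_simplyConnectedSpace` : any two morphisms `X ⟶ Y` of `Π₁(S)` agree
  when `S` is simply connected.
* `LocalSystem.nonempty_iso_const_of_simplyConnectedSpace` : `V ≅ const (V_{s₀})` for every base
  point `s₀`, the component at `s` being the transport along a path `s ⤳ s₀`.
* `LocalSystem.isTrivial_of_simplyConnectedSpace_holds` : the discharge.
-/

open CategoryTheory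

universe u

namespace Literature.AlgebraicGeometry.Motives

namespace LocalSystem

variable {R : Type u} [Ring R] {S : Type u} [TopologicalSpace S]

/-- In a simply connected space any two paths with the same end points are homotopic, so any two
morphisms `X ⟶ Y` of `Π₁(S)` coincide (Mathlib: `SimplyConnectedSpace` makes every
`Path.Homotopic.Quotient x y` a subsingleton). [folklore] -/
theorem hom_ext_of_simplyConnectedSpace [SimplyConnectedSpace S] {X Y : FundamentalGroupoid S}
    (f g : X ⟶ Y) : f = g :=
  Subsingleton.elim (α := Path.Homotopic.Quotient X.as Y.as) f g

/-- On a simply connected space, the transports along the unique homotopy classes of paths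
`s ⤳ s₀` assemble into an isomorphism `V ≅ const (V_{s₀})` of local systems whose component at
`s` is `V.transport ⟦somePath s s₀⟧` (Deligne 1970, I.1, Prop. 1.3 / Cor. 1.4 with `π₁ = 1`).
[cite: Deligne1970, I.1, Prop. 1.3 and Cor. 1.4 (p. 3)] -/
theorem nonempty_iso_const_of_simplyConnectedSpace [SimplyConnectedSpace S] (V : LocalSystem R S)
    (s₀ : S) :
    ∃ e : V ≅ const R S (V.fiber s₀), ∀ X : FundamentalGroupoid S,
      (e.hom.app X).hom = V.transport ⟦PathConnectedSpace.somePath X.as s₀⟧ := by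
  refine ⟨NatIso.ofComponents
    (fun X => V.mapIso ((Groupoid.isoEquivHom X (FundamentalGroupoid.mk s₀)).symm
      (FundamentalGroupoid.fromPath ⟦PathConnectedSpace.somePath X.as s₀⟧))) ?_, fun X => rfl⟩
  intro X Y f
  change V.map f ≫ V.map _ = V.map _ ≫ 𝟙 _
  rw [← V.map_comp, Category.comp_id, hom_ext_of_simplyConnectedSpace (f ≫ _)]

/-- **Discharge of `isTrivial_of_simplyConnectedSpace`.** On a simply connected space `S` every
local system `V` is trivial: `V ≅ const (V_{s₀})` for any base point `s₀` (a simply connected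
space is nonempty). Deligne 1970, I.1: Prop. 1.3 (locally constant sheaves on a connected `X`
≃ `π₁(X, x₀)`-sets via `F ↦ F_{x₀}`) and Cor. 1.4 (complex local systems ≃ finite-dimensional
representations of `π₁(X, x₀)`), p. 3; with `π₁ = 1` every local system is constant.
[cite: Deligne1970, I.1, Prop. 1.3 and Cor. 1.4 (p. 3)] -/
theorem isTrivial_of_simplyConnectedSpace_holds :
    isTrivial_of_simplyConnectedSpace (R := R) (S := S) := by
  intro _ V
  obtain ⟨s₀⟩ : Nonempty S := ((simply_connected_iff_unique_homotopic S).1 ‹_›).1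
  obtain ⟨e, -⟩ := V.nonempty_iso_const_of_simplyConnectedSpace s₀
  exact ⟨V.fiber s₀, ⟨e⟩⟩

end LocalSystem

end Literature.AlgebraicGeometry.Motives
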